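import Mathlib.Analysis.SumIntegralComparisons
import Mathlib.Analysis.SpecialFunctions.Integrals.Basic
import Mathlib.Analysis.Asymptotics.SpecificAsymptotics
import Mathlib.Analysis.SpecialFunctions.Pow.Asymptotics
import HarnessLib

/-!
# Partial sums of a sequence with a pure-power asymptote: `u_n ∼ c n^{δ−1} ⇒ Σ_{n≤T} u_n ∼ (c/δ) T^δ`

Topic `Literature/Analysis/Asymptotics` (discrete Abelian step of Karamata type, pure-power case).

Bingham–Goldie–Teugels, *Regular Variation* (1987), §1.5.6 (Karamata's theorem, direct half), Proposition 1.5.8: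
if `f` is regularly varying of index `ρ > −1` then `∫_X^x f(t) dt / (x f(x)) → 1/(ρ+1)`. We prove the DISCRETE
PURE-POWER instance needed by renewal arguments (e.g. the strong renewal theorem gives `u_n n^{1−δ} → c₁`, and the
mass `Σ_{n≤T} u_n` is then `∼ c₁ T^δ/δ`):

* `rpow_bounds_sum_range_rpow` — the integral-comparison sandwich
  `((T+1)^{a+1} − 1)/(a+1) ≤ Σ_{n=1}^{T} n^a ≤ 1 + ((T+1)^{a+1} − 1)/(a+1)` for `−1 < a ≤ 0`;
* `tendsto_sum_range_rpow_mul_rpow_neg` — `T^{−(a+1)} Σ_{n=1}^{T} n^a → 1/(a+1)` for `−1 < a ≤ 0`;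
* **`tendsto_sum_range_mul_rpow_neg`** — if `u_n · n^{1−δ} → c` with `0 < δ < 1` then
  `T^{−δ} Σ_{n=1}^{T} u_n → c/δ` (and the `Finset.Icc 1 T` form `tendsto_sum_Icc_mul_rpow_neg`).

Elementary: integral comparison for the antitone `x ↦ x^a` and `Asymptotics.IsLittleO.sum_range`.

Source locator: Bingham–Goldie–Teugels (1987), §1.5.6 "Karamata's Theorem", Proposition 1.5.8 (p. 26–27; direct
half, `σ > −(ρ+1)`), with the sequence version of §1.9 (regularly varying sequences); the book is not held by the
lane (acquisition request acq-10180), the locator is that of the standard CUP edition (Encyclopedia vol. 27).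

Relation to Mathlib (dedup): Mathlib has the harmonic case `Real.tendsto_sum_range_one_div_nat_succ_atTop` and the
exact Faulhaber sums `Finset.sum_range_id_mul_two`/`sum_range_pow` for NATURAL exponents, but no asymptotic for
`Σ_{n≤T} n^a` with real `a ∈ (−1, 0)`; this file is a thin wrapper around `AntitoneOn.integral_le_sum_Ico`,
`AntitoneOn.sum_le_integral_Ico` (`Mathlib.Analysis.SumIntegralComparisons`), `integral_rpow`,
`Asymptotics.IsLittleO.sum_range` and `tendsto_rpow_neg_atTop`.
-/

noncomputable section

open Filter Finset Asymptotics MeasureTheory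
open scoped Topology BigOperators

namespace Literature.Analysis.Asymptotics

/-! ### `Σ_{n=1}^T n^a` against `∫_1^{T+1} x^a dx` -/

/-- `x ↦ x^a` is antitone on `[1, ∞)` for `a ≤ 0`. [cite: BinghamGoldieTeugels1987, §1.5.6, Proposition 1.5.8 (p. 26)] -/
private theorem antitoneOn_rpow_Icc {a : ℝ} (ha0 : a ≤ 0) (T : ℕ) :
    AntitoneOn (fun x : ℝ => x ^ a) (Set.Icc ((1 : ℕ) : ℝ) ((T + 1 : ℕ) : ℝ)) := by
  intro x hx y hy hxy
  have hx1 : (0 : ℝ) < x := by have := hx.1; push_cast at this; linarith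
  exact Real.rpow_le_rpow_of_nonpos hx1 hxy ha0

/-- `∫_1^{T+1} x^a dx = ((T+1)^{a+1} − 1)/(a+1)` for `−1 < a`. [folklore] -/
private theorem integral_rpow_one (T : ℕ) {a : ℝ} (ha1 : -1 < a) :
    ∫ x in ((1 : ℕ) : ℝ)..((T + 1 : ℕ) : ℝ), x ^ a = (((T : ℝ) + 1) ^ (a + 1) - 1) / (a + 1) := by
  rw [integral_rpow (Or.inl ha1)]
  push_cast
  rw [Real.one_rpow]

/-- **Integral-comparison sandwich** for `S_T = Σ_{n=1}^{T} n^a`, `−1 < a ≤ 0`: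
`((T+1)^{a+1} − 1)/(a+1) ≤ S_T ≤ 1 + ((T+1)^{a+1} − 1)/(a+1)`.
[cite: BinghamGoldieTeugels1987, §1.5.6, Proposition 1.5.8 (p. 26)] -/
theorem rpow_bounds_sum_range_rpow {a : ℝ} (ha1 : -1 < a) (ha0 : a ≤ 0) (T : ℕ) :
    (((T : ℝ) + 1) ^ (a + 1) - 1) / (a + 1) ≤ ∑ i ∈ Finset.range T, ((i : ℝ) + 1) ^ a ∧
      ∑ i ∈ Finset.range T, ((i : ℝ) + 1) ^ a ≤ 1 + (((T : ℝ) + 1) ^ (a + 1) - 1) / (a + 1) := by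
  have hanti := antitoneOn_rpow_Icc ha0 T
  have hab : (1 : ℕ) ≤ T + 1 := by omega
  constructor
  · -- lower bound: `∫_1^{T+1} ≤ Σ_{x ∈ Ico 1 (T+1)} x^a`
    have h := AntitoneOn.integral_le_sum_Ico hab hanti
    rw [integral_rpow_one T ha1, Finset.sum_Ico_eq_sum_range] at h
    simpa [add_comm] using h
  · -- upper bound: `Σ_{i ∈ Ico 1 (T+1)} (i+1)^a ≤ ∫_1^{T+1}`, and `S_T ≤ 1 + that sum`
    have h := AntitoneOn.sum_le_integral_Ico hab hanti
    rw [integral_rpow_one T ha1, Finset.sum_Ico_eq_sum_range] at h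
    simp only [Nat.add_sub_cancel] at h
    -- `h : Σ_{k<T} ((1 + k) + 1)^a ≤ …`
    have hshift : ∑ i ∈ Finset.range T, ((i : ℝ) + 1) ^ a ≤
        1 + ∑ k ∈ Finset.range T, (((1 + k : ℕ) + 1 : ℕ) : ℝ) ^ a := by
      cases T with
      | zero => simp
      | succ T =>
        rw [Finset.sum_range_succ', Finset.sum_range_succ]
        have hnonneg : (0 : ℝ) ≤ (((1 + T : ℕ) + 1 : ℕ) : ℝ) ^ a := Real.rpow_nonneg (by positivity) _
        have hterm : ∀ k ∈ Finset.range T, (((k + 1 : ℕ) : ℝ) + 1) ^ a = (((1 + k : ℕ) + 1 : ℕ) : ℝ) ^ a := by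
          intro k _; push_cast; ring_nf
        rw [Finset.sum_congr rfl hterm]
        simp only [Nat.cast_zero, zero_add, Real.one_rpow]
        linarith
    exact hshift.trans (by linarith)

/-! ### `T^{−(a+1)} Σ_{n=1}^T n^a → 1/(a+1)` -/

/-- **`T^{−(a+1)} · Σ_{n=1}^{T} n^a → 1/(a+1)`** for `−1 < a ≤ 0` (the discrete Karamata direct half for a pure
power). [cite: BinghamGoldieTeugels1987, §1.5.6, Proposition 1.5.8 (p. 26)] -/
theorem tendsto_sum_range_rpow_mul_rpow_neg {a : ℝ} (ha1 : -1 < a) (ha0 : a ≤ 0) :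
    Tendsto (fun T : ℕ => (∑ i ∈ Finset.range T, ((i : ℝ) + 1) ^ a) * (T : ℝ) ^ (-(a + 1))) atTop
      (𝓝 (a + 1)⁻¹) := by
  have hb : 0 < a + 1 := by linarith
  -- the two comparison sequences
  have hratio : Tendsto (fun T : ℕ => (((T : ℝ) + 1) ^ (a + 1)) * (T : ℝ) ^ (-(a + 1))) atTop (𝓝 1) := by
    have h1 : Tendsto (fun T : ℕ => (1 + 1 / (T : ℝ)) ^ (a + 1)) atTop (𝓝 1) := by
      have : Tendsto (fun T : ℕ => 1 + 1 / (T : ℝ)) atTop (𝓝 (1 + 0)) :=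
        tendsto_const_nhds.add tendsto_one_div_atTop_nhds_zero_nat
      rw [add_zero] at this
      have := this.rpow_const (p := a + 1) (Or.inl one_ne_zero)
      rwa [Real.one_rpow] at this
    refine h1.congr' ?_
    filter_upwards [eventually_ge_atTop 1] with T hT
    have hTpos : (0 : ℝ) < T := by exact_mod_cast hT
    rw [show (1 : ℝ) + 1 / T = ((T : ℝ) + 1) / T by field_simp, Real.div_rpow (by positivity) hTpos.le,
      Real.rpow_neg hTpos.le, div_eq_mul_inv]
  have hsmall : Tendsto (fun T : ℕ => (T : ℝ) ^ (-(a + 1))) atTop (𝓝 0) :=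
    (tendsto_rpow_neg_atTop hb).comp tendsto_natCast_atTop_atTop
  -- lower and upper envelopes both tend to `1/(a+1)`
  have hlow : Tendsto (fun T : ℕ => (((T : ℝ) + 1) ^ (a + 1) - 1) / (a + 1) * (T : ℝ) ^ (-(a + 1))) atTop
      (𝓝 (a + 1)⁻¹) := by
    have := (hratio.sub hsmall).div_const (a + 1)
    rw [sub_zero, one_div] at this
    refine this.congr fun T => ?_
    ring
  have hup : Tendsto (fun T : ℕ => (1 + (((T : ℝ) + 1) ^ (a + 1) - 1) / (a + 1)) * (T : ℝ) ^ (-(a + 1)))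
      atTop (𝓝 (a + 1)⁻¹) := by
    have := hsmall.add hlow
    rw [zero_add] at this
    refine this.congr fun T => ?_
    ring
  refine tendsto_of_tendsto_of_tendsto_of_le_of_le hlow hup (fun T => ?_) (fun T => ?_)
  · exact mul_le_mul_of_nonneg_right (rpow_bounds_sum_range_rpow ha1 ha0 T).1
      (Real.rpow_nonneg (Nat.cast_nonneg T) _)
  · exact mul_le_mul_of_nonneg_right (rpow_bounds_sum_range_rpow ha1 ha0 T).2
      (Real.rpow_nonneg (Nat.cast_nonneg T) _)

/-! ### The Abelian step -/

/-- **Abelian step (pure power, discrete):** if `u_n · n^{1−δ} → c` with `0 < δ < 1`, then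
`T^{−δ} · Σ_{n=1}^{T} u_n → c/δ`. [cite: BinghamGoldieTeugels1987, §1.5.6, Proposition 1.5.8 (p. 26)] -/
theorem tendsto_sum_range_mul_rpow_neg {u : ℕ → ℝ} {δ c : ℝ} (hδ0 : 0 < δ) (hδ1 : δ < 1)
    (hu : Tendsto (fun n : ℕ => u n * (n : ℝ) ^ (1 - δ)) atTop (𝓝 c)) :
    Tendsto (fun T : ℕ => (∑ i ∈ Finset.range T, u (i + 1)) * (T : ℝ) ^ (-δ)) atTop (𝓝 (c / δ)) := by
  -- comparison sequence `g i = (i+1)^{δ-1}` and its partial sums `S`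
  set g : ℕ → ℝ := fun i => ((i : ℝ) + 1) ^ (δ - 1) with hg
  set S : ℕ → ℝ := fun T => ∑ i ∈ Finset.range T, g i with hS
  have hgpos : ∀ i, 0 < g i := fun i => Real.rpow_pos_of_pos (by positivity) _
  have hSlim : Tendsto (fun T : ℕ => S T * (T : ℝ) ^ (-δ)) atTop (𝓝 δ⁻¹) := by
    have h := tendsto_sum_range_rpow_mul_rpow_neg (a := δ - 1) (by linarith) (by linarith)
    simp only [sub_add_cancel] at h
    exact h
  -- `S T ≥ T^δ → ∞`
  have hSge : ∀ T : ℕ, (T : ℝ) ^ δ ≤ S T := by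
    intro T
    rcases Nat.eq_zero_or_pos T with rfl | hT
    · simp [hS, Real.zero_rpow hδ0.ne']
    have hTpos : (0 : ℝ) < T := by exact_mod_cast hT
    have hterm : ∀ i ∈ Finset.range T, (T : ℝ) ^ (δ - 1) ≤ g i := by
      intro i hi
      have hi' : ((i : ℝ) + 1) ≤ T := by exact_mod_cast Finset.mem_range.1 hi
      exact Real.rpow_le_rpow_of_nonpos (by positivity) hi' (by linarith)
    calc (T : ℝ) ^ δ = (T : ℝ) * (T : ℝ) ^ (δ - 1) := by
          rw [show δ = 1 + (δ - 1) by ring, Real.rpow_add hTpos, Real.rpow_one]; ring_nf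
      _ = ∑ _i ∈ Finset.range T, (T : ℝ) ^ (δ - 1) := by simp
      _ ≤ S T := Finset.sum_le_sum hterm
  have hStop : Tendsto S atTop atTop :=
    tendsto_atTop_mono hSge ((tendsto_rpow_atTop hδ0).comp tendsto_natCast_atTop_atTop)
  -- the error sequence `v i = u (i+1) - c g i` is `o(g)`
  set v : ℕ → ℝ := fun i => u (i + 1) - c * g i with hv
  have hvo : v =o[atTop] g := by
    refine (Asymptotics.isLittleO_iff_tendsto fun i hi => absurd hi (hgpos i).ne').2 ?_
    have hu1 : Tendsto (fun i : ℕ => u (i + 1) * (((i + 1 : ℕ) : ℝ)) ^ (1 - δ)) atTop (𝓝 c) :=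
      hu.comp (tendsto_add_atTop_nat 1)
    have : Tendsto (fun i : ℕ => u (i + 1) * (((i + 1 : ℕ) : ℝ)) ^ (1 - δ) - c) atTop (𝓝 (c - c)) :=
      hu1.sub tendsto_const_nhds
    rw [sub_self] at this
    refine this.congr fun i => ?_
    have hgi := hgpos i
    simp only [hv, hg]
    push_cast
    have hinv : ((i : ℝ) + 1) ^ (1 - δ) = (((i : ℝ) + 1) ^ (δ - 1))⁻¹ := by
      rw [← Real.rpow_neg (by positivity)]; congr 1; ring
    rw [hinv]
    field_simp
  have hsumo := Asymptotics.IsLittleO.sum_range hvo (fun i => (hgpos i).le) hStop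
  have hquot : Tendsto (fun T : ℕ => (∑ i ∈ Finset.range T, v i) / S T) atTop (𝓝 0) :=
    hsumo.tendsto_div_nhds_zero
  -- assemble: `Σ u = c S + Σ v`
  have hdecomp : ∀ T : ℕ, ∑ i ∈ Finset.range T, u (i + 1) = c * S T + ∑ i ∈ Finset.range T, v i := by
    intro T
    simp only [hS, hv, Finset.mul_sum, ← Finset.sum_add_distrib]
    exact Finset.sum_congr rfl fun i _ => by ring
  have hmain : Tendsto (fun T : ℕ => c * (S T * (T : ℝ) ^ (-δ)) +
      (∑ i ∈ Finset.range T, v i) / S T * (S T * (T : ℝ) ^ (-δ))) atTop (𝓝 (c * δ⁻¹ + 0 * δ⁻¹)) :=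
    (hSlim.const_mul c).add (hquot.mul hSlim)
  rw [zero_mul, add_zero, ← div_eq_mul_inv] at hmain
  refine hmain.congr' ?_
  filter_upwards [eventually_ge_atTop 1] with T hT
  have hSpos : 0 < S T := lt_of_lt_of_le (Real.rpow_pos_of_pos (by exact_mod_cast hT) _) (hSge T)
  rw [hdecomp T]
  field_simp

/-- The same with the sum written over `Finset.Icc 1 T`: if `u_n · n^{1−δ} → c` (`0 < δ < 1`) then
`T^{−δ} · Σ_{n ∈ [1,T]} u_n → c/δ`. [cite: BinghamGoldieTeugels1987, §1.5.6, Proposition 1.5.8 (p. 26)] -/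
theorem tendsto_sum_Icc_mul_rpow_neg {u : ℕ → ℝ} {δ c : ℝ} (hδ0 : 0 < δ) (hδ1 : δ < 1)
    (hu : Tendsto (fun n : ℕ => u n * (n : ℝ) ^ (1 - δ)) atTop (𝓝 c)) :
    Tendsto (fun T : ℕ => (∑ n ∈ Finset.Icc 1 T, u n) * (T : ℝ) ^ (-δ)) atTop (𝓝 (c / δ)) := by
  have hIcc : ∀ T : ℕ, ∑ n ∈ Finset.Icc 1 T, u n = ∑ i ∈ Finset.range T, u (i + 1) := by
    intro T
    induction T with
    | zero => simp
    | succ T ih => rw [Finset.sum_Icc_succ_top (by omega), ih, Finset.sum_range_succ]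
  simp only [hIcc]
  exact tendsto_sum_range_mul_rpow_neg hδ0 hδ1 hu

end Literature.Analysis.Asymptotics

end
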